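import Summits.QuantumFields.YangMills.Theorems.AlphaInputsT3ACv3NewtonLiftFlatLinearisationAllL
import Summits.QuantumFields.YangMills.Theorems.AlphaInputsT3ACv3NewtonLiftFlat
import Summits.QuantumFields.YangMills.Theorems.AlphaInputsT3ACv3NewtonShell
import Summits.QuantumFields.YangMills.Theorems.AlphaInputsT3ACv3LinearLiftMatrixCLMSub
import Summits.QuantumFields.YangMills.Theorems.AlphaInputsT3ACv3PerturbedPlaquetteFrame
import Literature.MathematicalPhysics.QuantumFieldTheory.Balaban1983to89.B7Prop2SpecialUnitary
import HarnessLib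

/-!
# `AlphaInputsT3ACv3NewtonLiftFlatAllL` — STRATEGY B for 2′, the (FL) row under OWNER RULING g24-№4: **THE MODEL NEWTON LIFT AT EVERY BLOCK SIZE `L ≥ 2`** (so `L = 3`, the
# record's block size, is covered) — the `…NewtonLiftFlat` theorem on ★w5's every-`L` derivative rows — lane `pub-balaban3d` ∕ cell `ym3-torus`, seat `ym-ust-19936-w4` (g0)

WHY (this seat's CLAIM R6-FLAT, 2026-08-28; memo `NEWTON-FL-FRAMES-w4-g0.md` §1).  The `hLift` binder of `…v3InnerLiftFromRegionalThm1` asks, for a level-`k` datum `V` on a region, a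
finest field with EXACT `k`-fold `blockAvg ℰp`-averages `V` and fine plaquettes `< B·ε·L^{−2k}`.  Its Newton engine, stripped of regions and stencil frames, is the following theorem,
assembled here from the tree BY NAME: if a finest `SU(n)` field `U₀` is η-flat (`‖U₀,b − 1‖ ≤ η`) and its `k`-fold average is η₀-close to `V` (`‖Ū₀^{(k)}(c)V(c)* − 1‖ ≤ η₀`) on every
coarse bond, then under ONE k-free smallness profile there is an `𝔰𝔲(n)`-valued correction `a` with `‖a_b‖ ≤ 4C_S·η₀·L^{−k}` such that `U = e^{a}U₀` has `Ū^{(k)} = V` EXACTLY and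
`dist1 U(∂p) ≤ dist1 U₀(∂p) + (16·18^d + 64C_S·(L^kη) + 256C_S²η₀)·η₀·L^{−2k}`.  The pieces: the shell `NewtonShell.exists_zero_in_range_of_approxRightInverse` (this seat) on w3's Banach
pair `E = piSub (lieSU n) 0`, `G = piSub (lieSU n) k` with `T = avgCLMS`, `R = liftSCLMS`, `T∘R = id` (`avgCLMS_liftSCLMS`, κ = 0), `‖R‖ ≤ C_S∕L^k` (★w2 g2's `liftS`); hypothesis (i) =
`…NewtonLiftFlatLinearisation.norm_mlogDefect_sub_sub_linAvgIterM_le` (★w1's R3 dressed); exactness = `NewtonDefectMap.eq_of_mlog_mul_star_eq_zero`; plaquettes =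
`PerturbedPlaquette.dist1_plaqHol_perturb_le` + `PerturbedPlaquetteFrame.norm_covCurl_sub_flatCurl_le_eta` + `norm_curlM_liftSCLMS_le`.
* ★★★ `exists_exact_lift_flat_allL` — the theorem of `…NewtonLiftFlat` with `d + 2 ≤ L` replaced by `k ≤ m + K` and the every-`L` scales `m′(x) = (d+1)L^k x`, constant
  `C_A = (d+1)C_S·5200ℓ²∕(L(L−1))`, bracket `β′ = 8ρ_D + 2C_A(m′(4r)+m′(2r+η)) + (2r+η) + (2m′(η)+η₀)`, one extra row `200ℓ(m′(4r)+m′(2r+η)) ≤ 1` ((i) = `norm_mlogDefect_sub_sub_linAvgIterM_le_allL`).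
HONEST FRAMING: the flat GLOBAL frame is the model case (no region, no stencil gauges — those enter through `…CovLinAvgFrame`, `…RelativeGauge`, `…PerturbedPlaquetteFrame` and the START of
memo v2.1 R9′∕R10); `hLift`∕(FL)∕2′ NOT proved here; count-neutral helper toward R3 2′ (items 19936∕19935); registry untouched; nothing about d = 4, the continuum, or a mass gap; YM₃ on T³
is rung R3, not Clay.

References: T. Bałaban, Commun. Math. Phys. 102 (1985) 277–309 [Balaban1985Variational] (Thm 1 (8) p.279, (11)–(15) pp.279–280); CMP 98 (1985) 17–51 [Balaban1985Averaging] (Props. 4–5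
pp.38–42, (19)–(23) p.21); CMP 109 (1987) 249–301 [Balaban1987RG1] ((0.4), (0.11) p.253).
-/

set_option autoImplicit false

noncomputable section

open scoped Matrix.Norms.L2Operator
open NormedSpace Metric

namespace Summit.QuantumFields.YangMills.Theorems.NewtonLiftFlat

-- every-L twin of `…NewtonLiftFlat`
open Literature.MathematicalPhysics.QuantumFieldTheory.Balaban1983to89
open Literature.MathematicalPhysics.QuantumFieldTheory.Balaban1983to89.MatrixLog (mlog mlog_one norm_mlog_le_two_mul)
open Literature.MathematicalPhysics.QuantumFieldTheory.Balaban1983to89.T4AdjointCovarianceUnitary (lieSU mem_lieSU_iff expSU coe_expSU)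
open T4Continuum BlockAveraging ExpMeanLog
open Literature.MathematicalPhysics.QuantumFieldTheory.Balaban1983to89.BlockAveragingEMLLinearised (linAvg)
open Summit.QuantumFields.YangMills.Theorems.LinearLiftMatrix
open Summit.QuantumFields.YangMills.Theorems.NewtonShell (exists_zero_in_range_of_approxRightInverse)
open Summit.QuantumFields.YangMills.Theorems.NewtonDefectMap (eq_of_mlog_mul_star_eq_zero)
open Summit.QuantumFields.YangMills.Theorems.PerturbedPlaquette (dist1_plaqHol_perturb_le exp_four_mul_sub_le_sq)
open Summit.QuantumFields.YangMills.Theorems.PerturbedPlaquetteFrame (norm_covCurl_sub_flatCurl_le_eta)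
open Summit.QuantumFields.YangMills.Theorems.Prop7HolRatioPerStep (coe_star_mul_self coe_mul_star_self)

variable {n : Type*} [Fintype n] [DecidableEq n] [Nonempty n] {P : Params}

set_option maxHeartbeats 1600000 in
/-- **★★★ THE MODEL NEWTON LIFT AT EVERY `L ≥ 2` (flat global frame).**  `k ≤ m + K`; `U₀` a finest `SU(n)` field with `‖U₀,b − 1‖ ≤ η`; `V` a level-`k` field with `‖Ū₀^{(k)}(c)·V(c)* − 1‖ ≤ η₀` on EVERY
coarse bond; a radius `0 < r ≤ 1/4`; with `m′(x) = (d+1)L^k·x`, `ρ_D = 2m′(2r) + η₀`, `C_A = (d+1)C_S·5200ℓ²∕(L(L−1))` and the k-FREE bracket `β′ = 8ρ_D + 2C_A(m′(4r)+m′(2r+η)) + (2r+η) + (2m′(η)+η₀)`, assume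
`C_A(m′(4r)+m′(2r+η)) ≤ 1`, `200ℓ(m′(4r)+m′(2r+η)) ≤ 1`, `4ℓ(m′(4r)+m′(2r+η)) < δ_N`, `ρ_D ≤ 1/4`, `|n|ρ_D < π`, `(d+1)·C_S·β ≤ 1/2`, `4C_S·η₀ ≤ r·L^k`.  THEN there are an `𝔰𝔲(n)`-valued finest one-form `a` with
`‖a_b‖ ≤ 4C_S·η₀∕L^k` and the field `U_b = e^{a_b}U₀,b` such that `Ū^{(k)} = V` on EVERY coarse bond and
`dist1 U(∂p) ≤ dist1 U₀(∂p) + (16·18^d + 64C_S·(L^kη) + 256C_S²·η₀)·η₀∕(L^k)²` at every finest plaquette — an EXACT `k`-fold (0.4)-lift whose correction is sup-small at scale `L^{−k}` and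
curl-small at scale `L^{−2k}`, all constants independent of `k`.  (Shell (N) on `E = piSub 𝔰𝔲 0`, `G = piSub 𝔰𝔲 k`, `T = avgCLMS`, `R = liftSCLMS`, κ = 0; (i) = `norm_mlogDefect_sub_sub_linAvgIterM_le_allL`.)
[cite: Balaban1985Variational, Thm 1 (8) p.279, (11)–(15) pp.279–280; Balaban1985Averaging, Props. 4–5 pp.38–42] -/
theorem exists_exact_lift_flat_allL {k : ℕ} (hk : k ≤ P.m + P.K)
    (U₀ : GaugeField P 0 (Matrix.specialUnitaryGroup n ℂ)) (V : GaugeField P k (Matrix.specialUnitaryGroup n ℂ))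
    {r η η₀ : ℝ} (hr : 0 < r) (hr4 : r ≤ 1 / 4) (hη : 0 ≤ η) (hη₀ : 0 ≤ η₀)
    (hU₀ : ∀ b, ‖((U₀ b : Matrix.specialUnitaryGroup n ℂ) : Matrix n n ℂ) - 1‖ ≤ η)
    (hV : ∀ c : PBond P k, ‖((Averaging.iter (fun i => blockAvg (P := P) (j := i) (expMeanLogSU (n := n))) k U₀ c : Matrix.specialUnitaryGroup n ℂ) : Matrix n n ℂ) *
        star ((V c : Matrix.specialUnitaryGroup n ℂ) : Matrix n n ℂ) - 1‖ ≤ η₀)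
    (h5200 : (((P.d : ℝ) + 1) * ((18 : ℝ) ^ P.d * (2 + ((P.d : ℝ) + 1) * (18 : ℝ) ^ P.d)) * (5200 * (((P.d + 2) * P.L : ℕ) : ℝ) ^ 2) / ((P.L : ℝ) * ((P.L : ℝ) - 1))) *
      ((((P.d : ℝ) + 1) * (P.L : ℝ) ^ k * (4 * r)) + (((P.d : ℝ) + 1) * (P.L : ℝ) ^ k * (2 * r + η))) ≤ 1)
    (h200 : 200 * (((P.d + 2) * P.L : ℕ) : ℝ) * ((((P.d : ℝ) + 1) * (P.L : ℝ) ^ k * (4 * r)) + (((P.d : ℝ) + 1) * (P.L : ℝ) ^ k * (2 * r + η))) ≤ 1)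
    (hN : 4 * (((P.d + 2) * P.L : ℕ) : ℝ) *
      ((((P.d : ℝ) + 1) * (P.L : ℝ) ^ k * (4 * r)) + (((P.d : ℝ) + 1) * (P.L : ℝ) ^ k * (2 * r + η))) < deltaSU n)
    (hρD : 2 * ((((P.d : ℝ) + 1) * (P.L : ℝ) ^ k * (2 * r))) + η₀ ≤ 1 / 4)
    (hρπ : (Fintype.card n : ℝ) * (2 * ((((P.d : ℝ) + 1) * (P.L : ℝ) ^ k * (2 * r))) + η₀) < Real.pi)
    (hcontr : ((P.d : ℝ) + 1) * CS P *
      (8 * (2 * ((((P.d : ℝ) + 1) * (P.L : ℝ) ^ k * (2 * r))) + η₀) +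
          2 * (((P.d : ℝ) + 1) * ((18 : ℝ) ^ P.d * (2 + ((P.d : ℝ) + 1) * (18 : ℝ) ^ P.d)) * (5200 * (((P.d + 2) * P.L : ℕ) : ℝ) ^ 2) / ((P.L : ℝ) * ((P.L : ℝ) - 1))) *
            ((((P.d : ℝ) + 1) * (P.L : ℝ) ^ k * (4 * r)) + (((P.d : ℝ) + 1) * (P.L : ℝ) ^ k * (2 * r + η))) +
          (2 * r + η) + (2 * ((((P.d : ℝ) + 1) * (P.L : ℝ) ^ k * η)) + η₀)) ≤ 1 / 2)
    (hdef : 4 * CS P * η₀ ≤ r * (P.L : ℝ) ^ k) :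
    ∃ (U : GaugeField P 0 (Matrix.specialUnitaryGroup n ℂ)) (a : PBond P 0 → Matrix n n ℂ),
      (∀ b, a b ∈ lieSU n) ∧ (∀ b, ((U b : Matrix.specialUnitaryGroup n ℂ) : Matrix n n ℂ) = exp (a b) * (U₀ b : Matrix n n ℂ)) ∧
      (∀ b, ‖a b‖ ≤ 4 * CS P * η₀ / (P.L : ℝ) ^ k) ∧
      (∀ c : PBond P k, Averaging.iter (fun i => blockAvg (P := P) (j := i) (expMeanLogSU (n := n))) k U c = V c) ∧
      (∀ p : Plaq P 0, GaugeGroup.dist1 (GaugeField.plaqHol U p) ≤ GaugeGroup.dist1 (GaugeField.plaqHol U₀ p) +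
        (16 * (18 : ℝ) ^ P.d + 64 * CS P * ((P.L : ℝ) ^ k * η) + 256 * (CS P) ^ 2 * η₀) * η₀ / ((P.L : ℝ) ^ k) ^ 2) := by
  classical
  -- letters
  set S : Submodule ℝ (Matrix n n ℂ) := lieSU n with hSdef
  set av : (i : ℕ) → Averaging P i (Matrix.specialUnitaryGroup n ℂ) := fun i => blockAvg (P := P) (j := i) (expMeanLogSU (n := n)) with hav
  set Lk : ℝ := (P.L : ℝ) ^ k with hLk
  have hLk0 : 0 < Lk := by rw [hLk]; have := P.L_pos; positivity
  have hCS := CS_pos P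
  let m : ℝ → ℝ := fun x => (((P.d : ℝ) + 1) * (P.L : ℝ) ^ k * x)
  have hm_def : ∀ x, m x = (((P.d : ℝ) + 1) * (P.L : ℝ) ^ k * x) := fun x => rfl
  have hA0 : 0 ≤ ((P.d : ℝ) + 1) * (P.L : ℝ) ^ k := by positivity
  have hm_mono : ∀ {x y : ℝ}, x ≤ y → m x ≤ m y := fun hxy => by
    rw [hm_def, hm_def]; exact mul_le_mul_of_nonneg_left hxy hA0
  have hm0 : ∀ {x : ℝ}, 0 ≤ x → 0 ≤ m x := fun hx => by rw [hm_def]; positivity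
  have hr1 : r ≤ 1 := by linarith
  have hr2 : r ≤ 1 / 2 := by linarith
  set ρD : ℝ := 2 * m (2 * r) + η₀ with hρDdef
  have hρD4 : ρD ≤ 1 / 4 := hρD
  have hρD1 : ρD < 1 := lt_of_le_of_lt hρD4 (by norm_num)
  have hL1 : (1 : ℝ) < P.L := by exact_mod_cast P.hL.2
  have hLL : 0 < (P.L : ℝ) * ((P.L : ℝ) - 1) := mul_pos (by linarith) (by linarith)
  set CA : ℝ := (((P.d : ℝ) + 1) * ((18 : ℝ) ^ P.d * (2 + ((P.d : ℝ) + 1) * (18 : ℝ) ^ P.d)) * (5200 * (((P.d + 2) * P.L : ℕ) : ℝ) ^ 2) / ((P.L : ℝ) * ((P.L : ℝ) - 1))) with hCA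
  have hCA0 : 0 ≤ CA := by rw [hCA]; exact div_nonneg (by positivity) hLL.le
  set C3 : ℝ := (((P.d : ℝ) + 1) * ((18 : ℝ) ^ P.d * (2 + ((P.d : ℝ) + 1) * (18 : ℝ) ^ P.d)) * (324 * (((P.d + 2) * P.L : ℕ) : ℝ) ^ 2) / ((P.L : ℝ) * ((P.L : ℝ) - 1))) with hC3
  have hC3le : C3 ≤ CA := by
    rw [hC3, hCA]; exact div_le_div_of_nonneg_right (by gcongr; norm_num) hLL.le
  have h200ℓ : 0 ≤ 200 * (((P.d + 2) * P.L : ℕ) : ℝ) := by positivity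
  set β : ℝ := 8 * ρD + 2 * CA * (m (4 * r) + m (2 * r + η)) + (2 * r + η) + (2 * m η + η₀) with hβ
  have hβ0 : 0 ≤ β := by
    have hρ0 : 0 ≤ ρD := add_nonneg (by have := hm0 (show (0:ℝ) ≤ 2 * r by positivity); linarith) hη₀
    have h4 := hm0 (show (0:ℝ) ≤ 4 * r by positivity); have h2 := hm0 (show (0:ℝ) ≤ 2 * r + η by positivity); have h1 := hm0 hη
    have hr0 : 0 ≤ r := hr.le
    rw [hβ]
    have : 0 ≤ 2 * CA * (m (4 * r) + m (2 * r + η)) := by positivity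
    positivity
  set Κ : ℝ := (((P.d : ℝ) + 1) * (P.L : ℝ) ^ k) * β with hΚ
  have hΚ0 : 0 ≤ Κ := mul_nonneg hA0 hβ0
  have hℓ0 : 0 ≤ 4 * (((P.d + 2) * P.L : ℕ) : ℝ) := by positivity
  have h2r : m (2 * r) ≤ m (4 * r) := hm_mono (by linarith)
  have hηm : m η ≤ m (2 * r + η) := hm_mono (by linarith)
  -- the Q-family of R3
  have hQ0 : ∀ Y : PBond P 0 → Matrix n n ℂ, linAvgIterM 0 Y = Y := fun Y => linAvgIterM_zero Y
  have hQs : ∀ (i : ℕ) (Y : PBond P 0 → Matrix n n ℂ) (c : PBond P (i + 1)), linAvgIterM (i + 1) Y c = linAvg (linAvgIterM i Y) c :=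
    fun i Y c => linAvgIterM_succ i Y c
  -- the Banach pair, `T`, `R`
  haveI : CompleteSpace ↥(piSub P S k) := completeSpace_piSub P S k
  set T : ↥(piSub P S 0) →L[ℝ] ↥(piSub P S k) := avgCLMS P S k with hT
  set R : ↥(piSub P S k) →L[ℝ] ↥(piSub P S 0) := liftSCLMS P S k hk with hR
  have hRn : ‖R‖ ≤ CS P / Lk := norm_liftSCLMS_le S k hk
  -- the perturbed fields and the defect
  let fieldOf : ↥(piSub P S 0) → GaugeField P 0 (Matrix.specialUnitaryGroup n ℂ) := fun x b =>
    expSU ⟨(x : PBond P 0 → Matrix n n ℂ) b, (mem_piSub P S).1 x.2 b⟩ * U₀ b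
  have hfield : ∀ (x : ↥(piSub P S 0)) (b : PBond P 0),
      ((fieldOf x b : Matrix.specialUnitaryGroup n ℂ) : Matrix n n ℂ) = exp ((x : PBond P 0 → Matrix n n ℂ) b) * (U₀ b : Matrix n n ℂ) := by
    intro x b
    show (((expSU ⟨(x : PBond P 0 → Matrix n n ℂ) b, (mem_piSub P S).1 x.2 b⟩ * U₀ b : Matrix.specialUnitaryGroup n ℂ)) : Matrix n n ℂ) = _
    rw [Submonoid.coe_mul, coe_expSU]
  let defect : ↥(piSub P S 0) → PBond P k → Matrix n n ℂ := fun x c =>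
    ((Averaging.iter av k (fieldOf x) c : Matrix.specialUnitaryGroup n ℂ) : Matrix n n ℂ) * star ((V c : Matrix.specialUnitaryGroup n ℂ) : Matrix n n ℂ)
  let Good : ↥(piSub P S 0) → Prop := fun x => ∀ c, ‖defect x c - 1‖ ≤ ρD
  -- in the ball: bondwise sizes, R3 against the start, the defect is ρ_D-close to `1`
  have hball : ∀ x : ↥(piSub P S 0), ‖x‖ ≤ r → ∀ b, ‖(x : PBond P 0 → Matrix n n ℂ) b‖ ≤ r := fun x hx b =>
    (norm_le_pi_norm (x : PBond P 0 → Matrix n n ℂ) b).trans hx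
  have hW_W₀ : ∀ x : ↥(piSub P S 0), ‖x‖ ≤ r → ∀ c : PBond P k,
      ‖((Averaging.iter av k (fieldOf x) c : Matrix.specialUnitaryGroup n ℂ) : Matrix n n ℂ) - ((Averaging.iter av k U₀ c : Matrix.specialUnitaryGroup n ℂ) : Matrix n n ℂ)‖ ≤
        2 * m (2 * r) := by
    intro x hx c
    have hxb := hball x hx
    have hUb : ∀ b, ‖((fieldOf x b : Matrix.specialUnitaryGroup n ℂ) : Matrix n n ℂ) - ((U₀ b : Matrix.specialUnitaryGroup n ℂ) : Matrix n n ℂ)‖ ≤ 2 * r :=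
      fun b => by rw [hfield x b]; exact norm_expField_sub_field_le (U₀ b) _ hr1 (hxb b)
    have h := EMLIterUniformAllL.norm_iter_sub_iter_sub_iterLin_le_uniform_allL linAvgIterM hQ0 hQs (fieldOf x) U₀ hη (by positivity) hU₀ hUb k hk
      (by
        have : C3 * m η ≤ CA * (m (4 * r) + m (2 * r + η)) :=
          mul_le_mul hC3le (hηm.trans (le_add_of_nonneg_left (hm0 (by positivity)))) (hm0 hη) hCA0
        exact this.trans h5200)
      (by
        have : 200 * (((P.d + 2) * P.L : ℕ) : ℝ) * (m (2 * r) + m η) ≤ 200 * (((P.d + 2) * P.L : ℕ) : ℝ) * (m (4 * r) + m (2 * r + η)) :=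
          mul_le_mul_of_nonneg_left (add_le_add h2r hηm) h200ℓ
        exact this.trans h200)
      (by
        have : CA * (m (2 * r) + m η) ≤ CA * (m (4 * r) + m (2 * r + η)) := mul_le_mul_of_nonneg_left (add_le_add h2r hηm) hCA0
        exact this.trans h5200)
      (by
        have : 4 * (((P.d + 2) * P.L : ℕ) : ℝ) * (m (2 * r) + m η) ≤ 4 * (((P.d + 2) * P.L : ℕ) : ℝ) * (m (4 * r) + m (2 * r + η)) :=
          mul_le_mul_of_nonneg_left (add_le_add h2r hηm) hℓ0
        exact lt_of_le_of_lt this hN)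
    exact (h k le_rfl c).1
  have hGood : ∀ x : ↥(piSub P S 0), ‖x‖ ≤ r → Good x := by
    intro x hx c
    have e : defect x c - 1 = (((Averaging.iter av k (fieldOf x) c : Matrix.specialUnitaryGroup n ℂ) : Matrix n n ℂ) -
        ((Averaging.iter av k U₀ c : Matrix.specialUnitaryGroup n ℂ) : Matrix n n ℂ)) * star ((V c : Matrix.specialUnitaryGroup n ℂ) : Matrix n n ℂ) +
        (((Averaging.iter av k U₀ c : Matrix.specialUnitaryGroup n ℂ) : Matrix n n ℂ) * star ((V c : Matrix.specialUnitaryGroup n ℂ) : Matrix n n ℂ) - 1) := by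
      show ((Averaging.iter av k (fieldOf x) c : Matrix.specialUnitaryGroup n ℂ) : Matrix n n ℂ) * star ((V c : Matrix.specialUnitaryGroup n ℂ) : Matrix n n ℂ) - 1 = _
      noncomm_ring
    rw [e]
    calc _ ≤ ‖(((Averaging.iter av k (fieldOf x) c : Matrix.specialUnitaryGroup n ℂ) : Matrix n n ℂ) -
          ((Averaging.iter av k U₀ c : Matrix.specialUnitaryGroup n ℂ) : Matrix n n ℂ)) * star ((V c : Matrix.specialUnitaryGroup n ℂ) : Matrix n n ℂ)‖ +
          ‖((Averaging.iter av k U₀ c : Matrix.specialUnitaryGroup n ℂ) : Matrix n n ℂ) * star ((V c : Matrix.specialUnitaryGroup n ℂ) : Matrix n n ℂ) - 1‖ := norm_add_le _ _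
      _ ≤ 2 * m (2 * r) + η₀ := by
          rw [CStarRing.norm_mul_mem_unitary _ (Unitary.star_mem (V c).2.1)]; exact add_le_add (hW_W₀ x hx c) (hV c)
  -- the defect map `Φ`
  let Φ : ↥(piSub P S 0) → ↥(piSub P S k) := fun x =>
    if h : Good x then ⟨fun c => mlog (defect x c), (mem_piSub P S).2 fun c => mlog_defect_mem_lieSU _ _ (h c) hρD4 hρπ⟩ else 0
  have hΦ_good : ∀ x : ↥(piSub P S 0), Good x → ((Φ x : ↥(piSub P S k)) : PBond P k → Matrix n n ℂ) = fun c => mlog (defect x c) := by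
    intro x hx
    show (((if h : Good x then ⟨fun c => mlog (defect x c), (mem_piSub P S).2 fun c => mlog_defect_mem_lieSU _ _ (h c) hρD4 hρπ⟩ else 0 : ↥(piSub P S k))) :
      PBond P k → Matrix n n ℂ) = _
    rw [dif_pos hx]
  -- hypothesis (i) of the shell
  have hΦ : ∀ x ∈ closedBall (0 : ↥(piSub P S 0)) r, ∀ x' ∈ closedBall (0 : ↥(piSub P S 0)) r, ‖Φ x' - Φ x - T (x' - x)‖ ≤ Κ * ‖x' - x‖ := by
    intro x hx x' hx'
    rw [mem_closedBall_zero_iff] at hx hx'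
    have hgx := hGood x hx
    have hgx' := hGood x' hx'
    rw [← Submodule.norm_coe, Submodule.coe_sub, Submodule.coe_sub, hΦ_good x hgx, hΦ_good x' hgx', hT, coe_avgCLMS, Submodule.coe_sub, avgCLM_apply k]
    refine (pi_norm_le_iff_of_nonneg (mul_nonneg hΚ0 (norm_nonneg _))).2 fun c => ?_
    have hΔ : ∀ b, ‖(x' : PBond P 0 → Matrix n n ℂ) b - (x : PBond P 0 → Matrix n n ℂ) b‖ ≤ ‖x' - x‖ := fun b => by
      rw [← Submodule.norm_coe, Submodule.coe_sub]; exact norm_le_pi_norm ((x' : PBond P 0 → Matrix n n ℂ) - (x : PBond P 0 → Matrix n n ℂ)) b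
    have hΔr : ‖x' - x‖ ≤ 2 * r := (norm_sub_le _ _).trans (by linarith)
    have hmain := norm_mlogDefect_sub_sub_linAvgIterM_le_allL hk U₀ (fieldOf x) (fieldOf x') V (x : PBond P 0 → Matrix n n ℂ) (x' : PBond P 0 → Matrix n n ℂ)
      (hfield x) (hfield x') hr2 hη hη₀ hΔr (hball x hx) (hball x' hx') hΔ hU₀ hV h5200 h200 hN (by linarith [hρD4]) c
    have e : linAvgIterM k ((x' : PBond P 0 → Matrix n n ℂ) - (x : PBond P 0 → Matrix n n ℂ)) c =
        linAvgIterM k (fun b => (x' : PBond P 0 → Matrix n n ℂ) b - (x : PBond P 0 → Matrix n n ℂ) b) c := rfl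
    rw [Pi.sub_apply, Pi.sub_apply, e]
    exact hmain
  -- hypothesis (ii): κ = 0
  have hRinv : ∀ u : ↥(piSub P S k), ‖T (R u) - u‖ ≤ 0 * ‖u‖ := fun u => by rw [hT, hR]; exact norm_avgCLMS_liftSCLMS_sub_le S k hk u
  -- radii
  set ρ : ℝ := r * Lk / CS P with hρ
  have hρ0 : 0 ≤ ρ := by rw [hρ]; positivity
  have hρr : ‖R‖ * ρ ≤ r := by
    have hLkne : Lk ≠ 0 := hLk0.ne'
    have hCSne : CS P ≠ 0 := hCS.ne'
    calc ‖R‖ * ρ ≤ (CS P / Lk) * ρ := mul_le_mul_of_nonneg_right hRn hρ0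
      _ = r * ((CS P * Lk) / (CS P * Lk)) := by rw [hρ]; ring
      _ = r := by rw [div_self (mul_ne_zero hCSne hLkne), mul_one]
  have hq' : Κ * ‖R‖ ≤ 1 / 2 := by
    calc Κ * ‖R‖ ≤ Κ * (CS P / Lk) := mul_le_mul_of_nonneg_left hRn hΚ0
      _ = ((P.d : ℝ) + 1) * CS P * β := by
          rw [hΚ, ← hLk]
          field_simp
      _ ≤ 1 / 2 := by rw [hβ, hρDdef]; exact hcontr
  have hq : 0 + Κ * ‖R‖ < 1 := by linarith
  -- the defect at the start
  have hgood0 : Good 0 := by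
    refine hGood 0 (by rw [norm_zero]; exact hr.le)
  have hΦ0 : ‖Φ 0‖ ≤ 2 * η₀ := by
    rw [← Submodule.norm_coe, hΦ_good 0 hgood0]
    refine (pi_norm_le_iff_of_nonneg (by positivity)).2 fun c => ?_
    have hf0 : fieldOf 0 = U₀ := by
      funext b
      apply Subtype.ext
      rw [hfield 0 b]
      show exp ((0 : PBond P 0 → Matrix n n ℂ) b) * (U₀ b : Matrix n n ℂ) = _
      rw [Pi.zero_apply, exp_zero, one_mul]
    show ‖mlog (((Averaging.iter av k (fieldOf 0) c : Matrix.specialUnitaryGroup n ℂ) : Matrix n n ℂ) * star ((V c : Matrix.specialUnitaryGroup n ℂ) : Matrix n n ℂ))‖ ≤ 2 * η₀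
    rw [hf0]
    exact (norm_mlog_le_two_mul ((hV c).trans (by linarith [hρD4, hm0 (show (0:ℝ) ≤ 2 * r by positivity)]))).trans (by linarith [hV c])
  have h0 : ‖Φ 0‖ ≤ (1 - (0 + Κ * ‖R‖)) * ρ := by
    have : 2 * η₀ ≤ (1 / 2) * ρ := by
      rw [hρ]
      have := hdef
      have hCS' : 0 < CS P := hCS
      rw [show (1:ℝ) / 2 * (r * Lk / CS P) = (r * Lk) / (2 * CS P) by field_simp]
      rw [le_div_iff₀ (by positivity)]
      nlinarith
    refine hΦ0.trans (this.trans ?_)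
    exact mul_le_mul_of_nonneg_right (by linarith) hρ0
  -- THE SHELL
  obtain ⟨u, huρ, hΦu, hub⟩ := exists_zero_in_range_of_approxRightInverse Φ T R hΦ hRinv le_rfl hΚ0 hq hρ0 hρr h0
  -- sizes of `u` and of the correction `a := R u`
  have hu4 : ‖u‖ ≤ 4 * η₀ := by
    refine hub.trans ?_
    rw [div_le_iff₀ (by linarith)]
    nlinarith [hΦ0, hq', norm_nonneg (Φ 0)]
  set a : PBond P 0 → Matrix n n ℂ := ((R u : ↥(piSub P S 0)) : PBond P 0 → Matrix n n ℂ) with ha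
  have hRu_norm : ‖R u‖ ≤ r := ((R.le_opNorm u).trans (mul_le_mul_of_nonneg_left huρ (norm_nonneg _))).trans hρr
  have hRu_norm' : ‖R u‖ ≤ (CS P / Lk) * ‖u‖ := (R.le_opNorm u).trans (mul_le_mul_of_nonneg_right hRn (norm_nonneg _))
  set δ : ℝ := (CS P / Lk) * (4 * η₀) with hδ
  have hδ0 : 0 ≤ δ := by rw [hδ]; positivity
  have haδ : ∀ b, ‖a b‖ ≤ δ := fun b => by
    rw [ha]
    refine (norm_le_pi_norm _ b).trans ?_
    rw [Submodule.norm_coe]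
    exact hRu_norm'.trans (mul_le_mul_of_nonneg_left hu4 (by positivity))
  have hδr : δ ≤ r := by
    rw [hδ]
    have := hdef
    rw [div_mul_eq_mul_div, div_le_iff₀ hLk0]
    nlinarith
  have hamem : ∀ b, a b ∈ lieSU n := fun b => liftSCLMS_apply_mem S k hk u b
  have hastar : ∀ b, star (a b) = -a b := fun b => (mem_lieSU_iff.1 (hamem b)).1
  -- the field
  set U : GaugeField P 0 (Matrix.specialUnitaryGroup n ℂ) := fieldOf (R u) with hUdef
  have hUa : ∀ b, ((U b : Matrix.specialUnitaryGroup n ℂ) : Matrix n n ℂ) = exp (a b) * (U₀ b : Matrix n n ℂ) := fun b => hfield (R u) b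
  refine ⟨U, a, hamem, hUa, fun b => (haδ b).trans (le_of_eq (by rw [hδ, hLk]; ring)), fun c => ?_, fun p => ?_⟩
  · -- exactness from the zero of `Φ`
    have hg : Good (R u) := hGood (R u) hRu_norm
    have hzero : mlog (defect (R u) c) = 0 := by
      have h1 : ((Φ (R u) : ↥(piSub P S k)) : PBond P k → Matrix n n ℂ) c = 0 := by rw [hΦu]; rfl
      rw [hΦ_good (R u) hg] at h1
      exact h1
    exact eq_of_mlog_mul_star_eq_zero _ _ (lt_of_le_of_lt (hg c) hρD1) hzero
  · -- plaquettes
    have hP := dist1_plaqHol_perturb_le U₀ U a hastar hUa p (haδ _) (haδ _) (haδ _) (haδ _)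
    have hflat := norm_covCurl_sub_flatCurl_le_eta U₀ a p (hU₀ _) (hU₀ _) (hU₀ _) (hU₀ _) (haδ _) (haδ _) (haδ _)
    have hcurl : ‖a ⟨p.src, p.μ⟩ + a ⟨p.src.shift p.μ, p.ν⟩ - a ⟨p.src.shift p.ν, p.μ⟩ - a ⟨p.src, p.ν⟩‖ ≤ (4 * (18 : ℝ) ^ P.d / Lk ^ 2) * ‖u‖ := by
      have h := norm_curlM_liftSCLMS_le S k hk u p.src (ne_of_lt p.hμν)
      rw [hLk]; exact h
    have h4δ : 4 * δ ≤ 1 := by linarith [hδr, hr4]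
    have hE := exp_four_mul_sub_le_sq hδ0 h4δ
    have key := norm_le_insert'
      (a ⟨p.src, p.μ⟩ + (U₀ ⟨p.src, p.μ⟩ : Matrix n n ℂ) * a ⟨p.src.shift p.μ, p.ν⟩ * star (U₀ ⟨p.src, p.μ⟩ : Matrix n n ℂ) -
          ((U₀ ⟨p.src, p.μ⟩ * U₀ ⟨p.src.shift p.μ, p.ν⟩ * (U₀ ⟨p.src.shift p.ν, p.μ⟩)⁻¹ : Matrix.specialUnitaryGroup n ℂ) : Matrix n n ℂ) * a ⟨p.src.shift p.ν, p.μ⟩ *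
            star ((U₀ ⟨p.src, p.μ⟩ * U₀ ⟨p.src.shift p.μ, p.ν⟩ * (U₀ ⟨p.src.shift p.ν, p.μ⟩)⁻¹ : Matrix.specialUnitaryGroup n ℂ) : Matrix n n ℂ) -
          ((GaugeField.plaqHol U₀ p : Matrix.specialUnitaryGroup n ℂ) : Matrix n n ℂ) * a ⟨p.src, p.ν⟩ * star ((GaugeField.plaqHol U₀ p : Matrix.specialUnitaryGroup n ℂ) : Matrix n n ℂ))
      (a ⟨p.src, p.μ⟩ + a ⟨p.src.shift p.μ, p.ν⟩ - a ⟨p.src.shift p.ν, p.μ⟩ - a ⟨p.src, p.ν⟩)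
    -- collect: dist1 U ≤ dist1 U₀ + (4·18^d/Lk²)‖u‖ + 16ηδ + 16δ²
    have hu0 : 0 ≤ ‖u‖ := norm_nonneg _
    have hsum : GaugeGroup.dist1 (GaugeField.plaqHol U p) ≤ GaugeGroup.dist1 (GaugeField.plaqHol U₀ p) + (4 * (18 : ℝ) ^ P.d / Lk ^ 2) * (4 * η₀) + 16 * η * δ + 16 * δ ^ 2 := by
      have hcurl' : ‖a ⟨p.src, p.μ⟩ + a ⟨p.src.shift p.μ, p.ν⟩ - a ⟨p.src.shift p.ν, p.μ⟩ - a ⟨p.src, p.ν⟩‖ ≤ (4 * (18 : ℝ) ^ P.d / Lk ^ 2) * (4 * η₀) :=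
        hcurl.trans (mul_le_mul_of_nonneg_left hu4 (by positivity))
      linarith [hP, hflat, key, hcurl', hE]
    have hLkne : Lk ≠ 0 := hLk0.ne'
    have hfinal : (4 * (18 : ℝ) ^ P.d / Lk ^ 2) * (4 * η₀) + 16 * η * δ + 16 * δ ^ 2 =
        (16 * (18 : ℝ) ^ P.d + 64 * CS P * (Lk * η) + 256 * (CS P) ^ 2 * η₀) * η₀ / Lk ^ 2 := by
      rw [hδ]
      field_simp
      ring
    linarith [hsum, hfinal.le]

end Summit.QuantumFields.YangMills.Theorems.NewtonLiftFlat

end
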